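import Summits.QuantumFields.YangMills.Theorems.LuscherReductionTwistedTraceScalingBTColourFP
import HarnessLib

/-!
# The KINETIC coupling on the orthographic tube against a constant lift is EXACT: `TC(orthoTube u v, constLift u') = Σ_e √(1−|v_e|²)·Re tr(u_k u'_k⁻¹)`
# — balance kills the linear term identically; the `v`-confinement is the MASS DEFECT `Σ_e (1 − √(1−|v_e|²))·Re tr(u_k u'_k⁻¹)`
# (lane A of S-BASE, crux `TwistedTraceScaling` stmt-QuantumFields-20203, C4-CORE, the (B-T) pen (F1); design note `pub/ym-fleet/ym-luscher-20007-p1/COARSE-DESIGN.md` §25.3)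

First of the exact quaternionic identities behind the Laplace evaluation of `fpBOKernel` (`…BTColourFP`, §25.3): every term of the phase is `Re tr(p·w)` with `p` a product of chart factors
and `w` a slow datum, and the LINEAR terms vanish on the slice by balance.  Here the kinetic term at a constant lift:
* §1 `re_trace_su2Rep_mul_inv` (`Re tr(AB⁻¹) = 2(A₀B₀ + A⃗·B⃗)`), ★ `re_trace_chartSU2_mul_mul_inv` — for `|v| ≤ 1`:
  `Re tr(chartSU2 v · u · u'⁻¹) = √(1−|v|²)·Re tr(u u'⁻¹) + 2 v·(u'u⁻¹)⃗` (the `v`-LINEAR term is paired with the vector part of the RELATIVE slow rotation `u'u⁻¹`);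
* §2 ★★ `timeCoupling_orthoTube_constLift` — for `v ∈ capBalancedSet L`: `TC(orthoTube u v, constLift u') = Σ_e √(1−|v_e|²)·Re tr(u_{dir e} u'_{dir e}⁻¹)` (the linear terms sum to
  `2Σ_k (Σ_x v_{(x,k)})·(u'_k u_k⁻¹)⃗ = 0`); ★★ `timeCoupling_orthoTube_constLift_eq_sub` — `= L³·TC₁(u,u') − Σ_e (1 − √(1−|v_e|²))·Re tr(u_k u'_k⁻¹)` (`timeCoupling_constLift`), and the
  symmetric form `timeCoupling_constLift_orthoTube`;
* §3 the elementary envelope `½t ≤ 1 − √(1−t) ≤ t` on `[0,1]` (`half_le_one_sub_sqrt_one_sub`, `one_sub_sqrt_one_sub_le`): so against a constant lift the tube point pays EXACTLY a kinetic mass between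
  `½Σ|v_e|²·Re tr(u_k u'_k⁻¹)` and `Σ|v_e|²·Re tr(u_k u'_k⁻¹)` — the Gaussian confinement of the fibre variable at width `β^{-1/2}`, with NO linear term and NO cubic remainder.
HONEST FRAMING: exact algebra for a stub of a child of the CONDITIONAL reduction route R2b1; the Laplace core of (B-T) is OPEN; C4-CORE OPEN; not infinite volume, not a gap, not Clay.
-/

set_option autoImplicit false

noncomputable section

open MeasureTheory Filter Topology Real
open scoped BigOperators Matrix
open Literature.MathematicalPhysics.QuantumFieldTheory
open Literature.MathematicalPhysics.QuantumLattice

namespace Summit.QuantumFields.YangMills.Theorems.FemtoTransferGap.TwoLattice.ConstTube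

open Summit.QuantumFields.YangMills.Theorems.FemtoTransferGap
open Summit.QuantumFields.YangMills.Theorems.FemtoTransferGap.TwoLattice.Cov (scalarPart_inv vecPart_inv)

variable {L : ℕ} [NeZero L]

/-! ## §1 One link: the chart factor against a relative slow rotation -/

/-- `Re tr(A·B⁻¹) = 2(A₀B₀ + A⃗·B⃗)` in `SU(2)`. [cite: BrockerTomDieck1985, I (1.10)] -/
theorem re_trace_su2Rep_mul_inv (A B : SU2) : ((su2Rep (A * B⁻¹)).trace).re = 2 * (scalarPart A * scalarPart B + vecPart A ⬝ᵥ vecPart B) := by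
  rw [show su2Rep (A * B⁻¹) = ((A * B⁻¹ : SU2) : Matrix (Fin 2) (Fin 2) ℂ) from rfl, re_trace_eq_two_mul_scalarPart, scalarPart_mul_inv]

/-- The scalar triple product: `(v × a)·b = v·(a × b)`. [folklore] -/
theorem cross_dotProduct_eq (v a b : Fin 3 → ℝ) : (v ⨯₃ a) ⬝ᵥ b = v ⬝ᵥ (a ⨯₃ b) := by
  simp only [cross_apply, dotProduct, Fin.sum_univ_three, Matrix.cons_val_zero, Matrix.cons_val_one, Matrix.head_cons, Matrix.cons_val_two, Matrix.tail_cons]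
  ring

/-- The vector part of the relative rotation: `(u'u⁻¹)⃗ = u₀·u⃗' − u'₀·u⃗ + u⃗ × u⃗'`. [folklore] -/
theorem vecPart_mul_inv_eq (u u' : SU2) : vecPart (u' * u⁻¹) = scalarPart u • vecPart u' - scalarPart u' • vecPart u + vecPart u ⨯₃ vecPart u' := by
  rw [vecPart_mul, scalarPart_inv, vecPart_inv]
  funext a
  fin_cases a <;>
    simp [cross_apply, Pi.add_apply, Pi.sub_apply, Pi.smul_apply, Pi.neg_apply, smul_eq_mul, Matrix.cons_val_zero, Matrix.cons_val_one, Matrix.head_cons,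
      Matrix.cons_val_two, Matrix.tail_cons] <;> ring

/-- ★ **The link identity**: for `|v| ≤ 1`, `Re tr(chartSU2 v · u · u'⁻¹) = √(1−|v|²)·Re tr(u u'⁻¹) + 2 v·(u'u⁻¹)⃗` — EXACTLY linear in `v` beyond the scalar factor. [folklore] -/
theorem re_trace_chartSU2_mul_mul_inv {v : Fin 3 → ℝ} (hv : ∑ a, v a ^ 2 ≤ 1) (u u' : SU2) :
    ((su2Rep (chartSU2 v * u * u'⁻¹)).trace).re = √(1 - ∑ a, v a ^ 2) * ((su2Rep (u * u'⁻¹)).trace).re + 2 * (v ⬝ᵥ vecPart (u' * u⁻¹)) := by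
  rw [re_trace_su2Rep_mul_inv, re_trace_su2Rep_mul_inv, scalarPart_mul, vecPart_mul, scalarPart_chartSU2 hv, vecPart_chartSU2 hv, vecPart_mul_inv_eq]
  simp only [dotProduct, Fin.sum_univ_three, cross_apply, Pi.add_apply, Pi.sub_apply, Pi.smul_apply, smul_eq_mul, Matrix.cons_val_zero, Matrix.cons_val_one,
    Matrix.head_cons, Matrix.cons_val_two, Matrix.tail_cons]
  ring

/-! ## §2 ★★ The tube against a constant lift -/

/-- ★★ **`TC(orthoTube u v, constLift u') = Σ_e √(1−|v_e|²)·Re tr(u_{dir e} u'_{dir e}⁻¹)`** for `v ∈ capBalancedSet L`: the linear terms sum to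
`2Σ_k (Σ_x v_{(x,k)})·(u'_k u_k⁻¹)⃗ = 0` by balance. [cite: Luscher1983, §3] -/
theorem timeCoupling_orthoTube_constLift (u u' : GaugeConfig 3 1 SU2) {v : Edge 3 L → Fin 3 → ℝ} (hv : v ∈ capBalancedSet L) :
    timeCoupling su2Rep (orthoTube L u v) (constLift L u') = ∑ e : Edge 3 L, √(1 - ∑ a, v e a ^ 2) * ((su2Rep (u (0, e.2) * (u' (0, e.2))⁻¹)).trace).re := by
  have hv1 : ∀ e : Edge 3 L, ∑ a, v e a ^ 2 ≤ 1 := sum_sq_le_one_of_cap L hv.2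
  unfold timeCoupling
  have hlink : ∀ e : Edge 3 L, ((su2Rep (orthoTube L u v e * (constLift L u' e)⁻¹)).trace).re =
      √(1 - ∑ a, v e a ^ 2) * ((su2Rep (u (0, e.2) * (u' (0, e.2))⁻¹)).trace).re + 2 * (v e ⬝ᵥ vecPart (u' (0, e.2) * (u (0, e.2))⁻¹)) := fun e => by
    rw [orthoTube_apply, constLift_apply, re_trace_chartSU2_mul_mul_inv (hv1 e)]
  rw [Finset.sum_congr rfl fun e _ => hlink e, Finset.sum_add_distrib]
  -- the linear part vanishes by balance
  have hlin : ∑ e : Edge 3 L, 2 * (v e ⬝ᵥ vecPart (u' (0, e.2) * (u (0, e.2))⁻¹)) = 0 := by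
    rw [Fintype.sum_prod_type]
    rw [Finset.sum_comm]
    refine Finset.sum_eq_zero fun k _ => ?_
    have hk : ∑ x : Site 3 L, 2 * (v (x, k) ⬝ᵥ vecPart (u' (0, k) * (u (0, k))⁻¹)) = 2 * ((∑ x : Site 3 L, v (x, k)) ⬝ᵥ vecPart (u' (0, k) * (u (0, k))⁻¹)) := by
      rw [← Finset.mul_sum, sum_dotProduct]
    rw [hk]
    have hzero : ∑ x : Site 3 L, v (x, k) = 0 := by
      funext a; rw [Finset.sum_apply]; exact hv.1 k a
    rw [hzero, zero_dotProduct, mul_zero]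
  rw [hlin, add_zero]

/-- ★★ **Mass-defect form**: `TC(orthoTube u v, constLift u') = L³·TC₁(u,u') − Σ_e (1 − √(1−|v_e|²))·Re tr(u_{dir e} u'_{dir e}⁻¹)`. [cite: Luscher1983, §3] -/
theorem timeCoupling_orthoTube_constLift_eq_sub (u u' : GaugeConfig 3 1 SU2) {v : Edge 3 L → Fin 3 → ℝ} (hv : v ∈ capBalancedSet L) :
    timeCoupling su2Rep (orthoTube L u v) (constLift L u') =
      (L : ℝ) ^ 3 * timeCoupling su2Rep u u' - ∑ e : Edge 3 L, (1 - √(1 - ∑ a, v e a ^ 2)) * ((su2Rep (u (0, e.2) * (u' (0, e.2))⁻¹)).trace).re := by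
  rw [timeCoupling_orthoTube_constLift u u' hv, ← timeCoupling_constLift su2Rep L u u']
  unfold timeCoupling
  simp only [constLift_apply]
  rw [← Finset.sum_sub_distrib]
  exact Finset.sum_congr rfl fun e _ => by ring

/-- The symmetric form: `TC(constLift u, orthoTube u' v') = Σ_e √(1−|v'_e|²)·Re tr(u_{dir e} u'_{dir e}⁻¹)`. [cite: Luscher1983, §3] -/
theorem timeCoupling_constLift_orthoTube (u u' : GaugeConfig 3 1 SU2) {v' : Edge 3 L → Fin 3 → ℝ} (hv' : v' ∈ capBalancedSet L) :
    timeCoupling su2Rep (constLift L u) (orthoTube L u' v') = ∑ e : Edge 3 L, √(1 - ∑ a, v' e a ^ 2) * ((su2Rep (u (0, e.2) * (u' (0, e.2))⁻¹)).trace).re := by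
  have hsymm : ∀ U V : GaugeConfig 3 L SU2, timeCoupling su2Rep U V = timeCoupling su2Rep V U := fun U V => by
    unfold timeCoupling
    refine Finset.sum_congr rfl fun e _ => ?_
    rw [re_trace_su2Rep_mul_inv, re_trace_su2Rep_mul_inv, mul_comm (scalarPart (U e)), dotProduct_comm]
  rw [hsymm, timeCoupling_orthoTube_constLift u' u hv']
  refine Finset.sum_congr rfl fun e _ => ?_
  rw [re_trace_su2Rep_mul_inv, re_trace_su2Rep_mul_inv, mul_comm (scalarPart (u' (0, e.2))), dotProduct_comm]

/-! ## §3 The mass-defect envelope -/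

/-- `1 − √(1−t) ≤ t` for `0 ≤ t ≤ 1`. [folklore] -/
theorem one_sub_sqrt_one_sub_le {t : ℝ} (ht0 : 0 ≤ t) (ht1 : t ≤ 1) : 1 - √(1 - t) ≤ t := by
  have h1 : 0 ≤ 1 - t := by linarith
  have hs : 1 - t ≤ √(1 - t) := by
    have h := Real.sqrt_le_sqrt (mul_le_of_le_one_left h1 (by linarith : 1 - t ≤ 1))
    rw [show (1 - t) * (1 - t) = (1 - t) ^ 2 by ring, Real.sqrt_sq h1] at h
    exact h
  linarith

/-- `t/2 ≤ 1 − √(1−t)` for `0 ≤ t ≤ 1`. [folklore] -/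
theorem half_le_one_sub_sqrt_one_sub {t : ℝ} (ht0 : 0 ≤ t) (ht1 : t ≤ 1) : t / 2 ≤ 1 - √(1 - t) := by
  have h1 : 0 ≤ 1 - t := by linarith
  have hs : √(1 - t) ≤ 1 - t / 2 := by
    rw [Real.sqrt_le_left (by linarith)]
    nlinarith
  linarith

/-- ★ **The kinetic mass on the tube is two-sided Gaussian**: if every `Re tr(u_k u'_k⁻¹) ≥ 0` (slow data within `π/2` of each other) then
`L³TC₁(u,u') − Σ_e|v_e|²·Re tr(u_k u'_k⁻¹) ≤ TC(orthoTube u v, constLift u') ≤ L³TC₁(u,u') − ½Σ_e|v_e|²·Re tr(u_k u'_k⁻¹)`. [cite: Luscher1983, §3] -/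
theorem timeCoupling_orthoTube_constLift_sandwich (u u' : GaugeConfig 3 1 SU2) {v : Edge 3 L → Fin 3 → ℝ} (hv : v ∈ capBalancedSet L)
    (hpos : ∀ k : Fin 3, 0 ≤ ((su2Rep (u (0, k) * (u' (0, k))⁻¹)).trace).re) :
    (L : ℝ) ^ 3 * timeCoupling su2Rep u u' - ∑ e : Edge 3 L, (∑ a, v e a ^ 2) * ((su2Rep (u (0, e.2) * (u' (0, e.2))⁻¹)).trace).re ≤
        timeCoupling su2Rep (orthoTube L u v) (constLift L u') ∧
      timeCoupling su2Rep (orthoTube L u v) (constLift L u') ≤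
        (L : ℝ) ^ 3 * timeCoupling su2Rep u u' - ∑ e : Edge 3 L, (∑ a, v e a ^ 2) / 2 * ((su2Rep (u (0, e.2) * (u' (0, e.2))⁻¹)).trace).re := by
  have hv1 : ∀ e : Edge 3 L, ∑ a, v e a ^ 2 ≤ 1 := sum_sq_le_one_of_cap L hv.2
  have hv0 : ∀ e : Edge 3 L, 0 ≤ ∑ a, v e a ^ 2 := fun e => Finset.sum_nonneg fun a _ => sq_nonneg _
  rw [timeCoupling_orthoTube_constLift_eq_sub u u' hv]
  constructor
  · have h : ∑ e : Edge 3 L, (1 - √(1 - ∑ a, v e a ^ 2)) * ((su2Rep (u (0, e.2) * (u' (0, e.2))⁻¹)).trace).re ≤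
        ∑ e : Edge 3 L, (∑ a, v e a ^ 2) * ((su2Rep (u (0, e.2) * (u' (0, e.2))⁻¹)).trace).re :=
      Finset.sum_le_sum fun e _ => mul_le_mul_of_nonneg_right (one_sub_sqrt_one_sub_le (hv0 e) (hv1 e)) (hpos e.2)
    linarith
  · have h : ∑ e : Edge 3 L, (∑ a, v e a ^ 2) / 2 * ((su2Rep (u (0, e.2) * (u' (0, e.2))⁻¹)).trace).re ≤
        ∑ e : Edge 3 L, (1 - √(1 - ∑ a, v e a ^ 2)) * ((su2Rep (u (0, e.2) * (u' (0, e.2))⁻¹)).trace).re :=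
      Finset.sum_le_sum fun e _ => mul_le_mul_of_nonneg_right (half_le_one_sub_sqrt_one_sub (hv0 e) (hv1 e)) (hpos e.2)
    linarith

end Summit.QuantumFields.YangMills.Theorems.FemtoTransferGap.TwoLattice.ConstTube

end
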